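import Mathlib
import Literature.Computability.AlgebraicComplexity.NestFreeMatchingPoly
import Literature.Computability.AlgebraicComplexity.ArithCircuitProofs
import Summits.ValiantsHypothesis.ValiantsHypothesis.Theorems.FifoMatchingNNDivisionHardPinnedRainbowFace
import Summits.ValiantsHypothesis.ValiantsHypothesis.Theorems.FifoMatchingNNMonotoneExpBound
import Summits.ValiantsHypothesis.ValiantsHypothesis.Theorems.FifoMatchingNNDivisionHardCorSandwich
import HarnessLib

/-!
# Route FifoMatching — crux `NNDivisionHard` (stmt-ValiantsHypothesis-21181): STACK POWERS DO NOT HELP THE QUEUE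

The M-sized residual step isolated by the two previous hands on stmt-21181 (`…NNDivisionHardFaceReading`: «once the face
identification is typed (next hand: M-sized)»; `…NNDivisionHardStackPowers`: «WHAT REMAINS for "stack powers do not help the
queue"»), CARRIED OUT.  With the face identification `top_w(NN_n) = x^{pins} · ι(NN_a)` of `…NNDivisionHardPinnedRainbowFace`
(block size `a`, `4a+2 ≤ 2n`, `n ≤ 3a+1`, pinned rainbow direction `w = (n+1)·𝟙_R + 𝟙_{pins}`):

* ★ `complexity_nn_le_of_generic` — GENERIC-COFACTOR RUNG: for every cofactor `h` with a unique `w`-maximal monomial,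
  `L₊(NN_a) ≤ 5184 · (2n+1)⁶ · (L₊(NN_n · h) + 1)⁴` (face reading `FaceReading.complexity_face_le_of_generic`, the face
  identification, Jukna–Seiwert–Sergeev stripping of `x^{pins}` `MonomialStripping.complexity_le_of_monomial_mul`, and
  `complexity_rename_of_injective`);
* ★ `complexity_nn_le_of_stackPower` — the same for EVERY stack power `h = NC_n^k` (`StackPowers.generic_noncrossingPow`:
  the pinned rainbow direction is generic for `NC_n^k`, whose unique maximal monomial is `k·χ_rev`);
* ★★ `stackPower_exp_bound` — eventually in `n`, for every `k`: `2^{⌊(n+2)/3⌋^{1/6}} ≤ 5184 (2n+1)⁶ (L₊(NN_n · NC_n^k)+1)⁴`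
  (`NNMonotoneExpBound.exp_lower_bound` at `a = ⌊(n+2)/3⌋`);
* `qp_threshold` — the quasi-polynomial bookkeeping, once: eventually `L₊(NN_{⌊(n+2)/3⌋}) ≤ 5184(2n+1)⁶(L+1)⁴ ⇒
  2^((log₂ n + c)^c) < L` (`CorSandwich.polylog_lt_rpow_eventually`);
* ★★ `stackPower_not_certificate_qp` — in the currency of the route decl `Theses.FifoMatching.NNDivisionHard`: for every
  `c`, eventually in `n`, **`2^((log₂ n + c)^c) < L₊(NN_n · NC_n^k) + L₊(NC_n^k)` for EVERY `k`** — the instance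
  `h ∈ {NC_n^k}` of the crux, proved uniformly in `k`;
* ★★ `generic_not_certificate_qp` — the same for EVERY cofactor `h` generic in the pinned rainbow direction
  `prWeight n ⌊(n+2)/3⌋` (the crux inequality on a whole class: all `h` whose Newton polytope has a vertex exposed by `w`).

So the residual test cofactor of the unsaturated / content-free tier (`…UnsaturatedTier`, `…ContentFree`: `h = NC_n^k`,
cheap `L₊ = O(n³ + log k)`, hyper-degree, torus-homogeneous, carrying no monomial inside a typical nest-free matching) is NOT a
quasi-polynomial certificate: «stack powers do not help the queue», complementing «powers are not certificates»
(`…NNPowersNotCertificates`) and the saturated-cofactor rung (`…NNSaturatedCofactors`).  More generally ANY cofactor generic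
in some pinned rainbow direction is eliminated (`complexity_nn_le_of_generic`).

HONEST FRAMING: one more explicit cofactor family leaves the open residual of stmt-21181 by a support/face argument; the crux
(all `h ≠ 0`) stays OPEN (Hrubeš–Yehudayoff 2021 §6 Problem 2); nothing here bears on `NNNotVP` or on VP ≠ VNP (NOT proved).
References: Jukna–Seiwert–Sergeev 2022 Thm 1 [JuknaSeiwertSergeev2022]; Hrubeš–Yehudayoff 2021 §6 Problem 2, Prop. 43(3)
[HrubesYehudayoff2021]; Chen–Deng–Du–Stanley–Yan 2007 §1 [ChenDengDuStanleyYan2007].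
-/

noncomputable section

-- Sub = Summit single-conjunct layout: the duplicated namespace component is mandated by the tree.
set_option linter.dupNamespace false
set_option autoImplicit false

namespace Summit.ValiantsHypothesis.ValiantsHypothesis.Theorems.FifoMatching.NNDivisionHard.StackPowersQueue

open Finset MvPolynomial Literature.Computability.AlgebraicComplexity
open Summit.ValiantsHypothesis.ValiantsHypothesis.Theorems.ZeroOneTransfer.Negative (topComponent)
open Summit.ValiantsHypothesis.ValiantsHypothesis.Theorems.FifoMatching.NNDivisionHard.FaceReading
  (complexity_face_le_of_generic)
open Summit.ValiantsHypothesis.ValiantsHypothesis.Theorems.FifoMatching.NNDivisionHard.StackPowers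
  (generic_noncrossingPow nsmul_rev_mem_support_noncrossingPow)
open Summit.ValiantsHypothesis.ValiantsHypothesis.Theorems.DivisionGap.PerCofactorDegreeReduction.MonomialStripping
  (complexity_le_of_monomial_mul)
open scoped NNReal BigOperators

variable {n a : ℕ}

/-! ### §1 Reading the pinned rainbow face: a generic cofactor computes `NN_a` at polynomial cost -/

/-- ★ **GENERIC-COFACTOR RUNG.**  For `4a+2 ≤ 2n`, `n ≤ 3a+1` and every cofactor `h` for which the pinned rainbow direction
`w = (n+1)·𝟙_R + 𝟙_{pins}` is GENERIC (a unique `w`-maximal monomial `x^e` of `h`):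
`L₊(NN_a) ≤ 5184 · (2n+1)⁶ · (L₊(NN_n · h) + 1)⁴` — face reading (`FaceReading.complexity_face_le_of_generic`), the face
identification `top_w(NN_n) = x^{pins} · ι(NN_a)` (`topComponent_eq`), Jukna–Seiwert–Sergeev stripping of `x^{pins}`
(`MonomialStripping.complexity_le_of_monomial_mul`) and invariance of `L₊` under the injective renaming `ι`.
[cite: JuknaSeiwertSergeev2022, Thm 1] [cite: HrubesYehudayoff2021, §6 Problem 2] -/
theorem complexity_nn_le_of_generic (h1 : 4 * a + 2 ≤ 2 * n) (h2 : n ≤ 3 * a + 1)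
    (h : MvPolynomial (Fin (2 * n) × Fin (2 * n)) ℝ≥0) {e : (Fin (2 * n) × Fin (2 * n)) →₀ ℕ}
    (he : e ∈ h.support)
    (hgen : ∀ e' ∈ h.support, e' ≠ e → Finsupp.weight (prWeight n a) e' < Finsupp.weight (prWeight n a) e) :
    complexity (nestFreeMatchingPoly a ℝ≥0) ≤
      5184 * (2 * n + 1) ^ 6 * (complexity (nestFreeMatchingPoly n ℝ≥0 * h) + 1) ^ 4 := by
  have hle : 2 * a ≤ 2 * n := by omega
  have hface := complexity_face_le_of_generic n (prWeight n a) h he hgen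
  rw [topComponent_eq h1 h2 hle] at hface
  have hstrip := complexity_le_of_monomial_mul (2 * n) (pinExp n a)
    (rename (blockEmb hle) (nestFreeMatchingPoly a ℝ≥0))
  rw [complexity_rename_of_injective_holds (blockEmb_injective hle)] at hstrip
  set L := complexity (nestFreeMatchingPoly n ℝ≥0 * h)
  set X := complexity (monomial (pinExp n a) (1 : ℝ≥0) * rename (blockEmb hle) (nestFreeMatchingPoly a ℝ≥0))
  have hy : 1 ≤ ((2 * n + 1) * (L + 1)) ^ 2 := Nat.one_le_pow _ _ (Nat.mul_pos (by omega) (by omega))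
  calc complexity (nestFreeMatchingPoly a ℝ≥0) ≤ 16 * ((2 * n + 1) * (X + 1)) ^ 2 := hstrip
    _ ≤ 16 * ((2 * n + 1) * (16 * ((2 * n + 1) * (L + 1)) ^ 2 + 1 + 1)) ^ 2 := by gcongr
    _ ≤ 16 * ((2 * n + 1) * (18 * ((2 * n + 1) * (L + 1)) ^ 2)) ^ 2 := by gcongr; omega
    _ = 5184 * (2 * n + 1) ^ 6 * (L + 1) ^ 4 := by ring

/-- ★ **STACK POWERS READ THE QUEUE.**  For `4a+2 ≤ 2n`, `n ≤ 3a+1` and EVERY `k`: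
`L₊(NN_a) ≤ 5184 · (2n+1)⁶ · (L₊(NN_n · NC_n^k) + 1)⁴` — the pinned rainbow direction is generic for `NC_n^k`
(`StackPowers.generic_noncrossingPow`: `k·χ_rev` is its unique maximal monomial). [cite: JuknaSeiwertSergeev2022, Thm 1] -/
theorem complexity_nn_le_of_stackPower (h1 : 4 * a + 2 ≤ 2 * n) (h2 : n ≤ 3 * a + 1) (k : ℕ) :
    complexity (nestFreeMatchingPoly a ℝ≥0) ≤
      5184 * (2 * n + 1) ^ 6 *
        (complexity (nestFreeMatchingPoly n ℝ≥0 * (noncrossingMatchingPoly n ℝ≥0) ^ k) + 1) ^ 4 := by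
  refine complexity_nn_le_of_generic h1 h2 ((noncrossingMatchingPoly n ℝ≥0) ^ k)
    (nsmul_rev_mem_support_noncrossingPow n k) fun e' he' hne => ?_
  obtain ⟨hle, heq⟩ := generic_noncrossingPow (Nat.lt_succ_self n) (prWeight n a) (pinWeight n a)
    pinWeight_le_one prWeight_eq k e' he'
  rw [map_nsmul, smul_eq_mul]
  exact lt_of_le_of_ne hle fun h => hne (heq h)

/-! ### §2 Stack powers are not certificates -/

/-- ★★ **STACK POWERS DO NOT HELP THE QUEUE (stretched-exponential form).**  Eventually in `n`, for EVERY `k`: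
`2^{⌊(n+2)/3⌋^{1/6}} ≤ 5184 · (2n+1)⁶ · (L₊(NN_n · NC_n^k) + 1)⁴` (take `a = ⌊(n+2)/3⌋` and the landed uniform bound
`NNMonotoneExpBound.exp_lower_bound : 2^{a^{1/6}} ≤ L₊(NN_a)`). [cite: JuknaSeiwertSergeev2022, Thm 1]
[cite: HrubesYehudayoff2021, §6 Problem 2] -/
theorem stackPower_exp_bound : ∃ n₀ : ℕ, ∀ n : ℕ, n₀ ≤ n → ∀ k : ℕ,
    (2 : ℝ) ^ ((((n + 2) / 3 : ℕ) : ℝ) ^ ((1 : ℝ) / 6)) ≤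
      ((5184 * (2 * n + 1) ^ 6 *
        (complexity (nestFreeMatchingPoly n ℝ≥0 * (noncrossingMatchingPoly n ℝ≥0) ^ k) + 1) ^ 4 : ℕ) : ℝ) := by
  obtain ⟨n₁, hn₁⟩ := NNMonotoneExpBound.exp_lower_bound
  refine ⟨3 * n₁ + 7, fun n hn k => ?_⟩
  have h1 : 4 * ((n + 2) / 3) + 2 ≤ 2 * n := by omega
  have h2 : n ≤ 3 * ((n + 2) / 3) + 1 := by omega
  exact (hn₁ _ (by omega)).trans (by exact_mod_cast complexity_nn_le_of_stackPower h1 h2 k)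

/-- Exponent bookkeeping for the quasi-polynomial reading: `4(ℓ+c)^c + 6ℓ + 29 ≤ (ℓ' + (c+36))^(c+36)` whenever
`ℓ ≤ ℓ' + 2`. [folklore] -/
theorem exponent_le (c ℓ ℓ' : ℕ) (hℓ : ℓ ≤ ℓ' + 2) :
    4 * (ℓ + c) ^ c + 6 * ℓ + 29 ≤ (ℓ' + (c + 36)) ^ (c + 36) := by
  set t := ℓ' + c + 2 with ht
  have ht1 : 1 ≤ t := by omega
  have hq : (ℓ + c) ^ c ≤ t ^ c := Nat.pow_le_pow_left (by omega) c
  have htc : 1 ≤ t ^ c := Nat.one_le_pow _ _ (by omega)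
  have hA : 4 * t ^ c + 6 * t + 29 ≤ t ^ c * (t + 34) ^ 2 :=
    calc 4 * t ^ c + 6 * t + 29 ≤ 68 * t * t ^ c + 1156 * t ^ c := by
          have e1 : 6 * t ≤ 68 * t * t ^ c :=
            calc 6 * t ≤ 68 * t := by omega
              _ = 68 * t * 1 := (mul_one _).symm
              _ ≤ 68 * t * t ^ c := Nat.mul_le_mul_left _ htc
          omega
      _ ≤ t ^ c * t ^ 2 + (68 * t * t ^ c + 1156 * t ^ c) := Nat.le_add_left _ _
      _ = t ^ c * (t + 34) ^ 2 := by ring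
  have hB : t ^ c * (t + 34) ^ 2 ≤ (t + 34) ^ c * (t + 34) ^ 36 :=
    Nat.mul_le_mul (Nat.pow_le_pow_left (by omega) c) (Nat.pow_le_pow_right (by omega) (by norm_num))
  rw [← pow_add] at hB
  have : ℓ' + (c + 36) = t + 34 := by omega
  rw [this]
  omega

/-- **Quasi-polynomial threshold.**  For every `c`, eventually in `n`: whenever `L₊(NN_{⌊(n+2)/3⌋}) ≤ 5184 (2n+1)⁶ (L+1)⁴`,
then `2^((log₂ n + c)^c) < L` — the stretched-exponential bound `2^{a^{1/6}} ≤ L₊(NN_a)` (`NNMonotoneExpBound.exp_lower_bound`)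
against `CorSandwich.polylog_lt_rpow_eventually`, with the bookkeeping `exponent_le`. [folklore] -/
theorem qp_threshold (c : ℕ) : ∃ n₀ : ℕ, ∀ n : ℕ, n₀ ≤ n → ∀ L : ℕ,
    complexity (nestFreeMatchingPoly ((n + 2) / 3) ℝ≥0) ≤ 5184 * (2 * n + 1) ^ 6 * (L + 1) ^ 4 →
      2 ^ ((Nat.log 2 n + c) ^ c) < L := by
  obtain ⟨n₁, hn₁⟩ := NNMonotoneExpBound.exp_lower_bound
  obtain ⟨n₂, hn₂⟩ := CorSandwich.polylog_lt_rpow_eventually (c + 36) (c := 1 / 6) (by norm_num)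
  refine ⟨3 * (n₁ + n₂) + 7, fun n hn L HA => ?_⟩
  set a := (n + 2) / 3 with ha
  have ha0 : a ≠ 0 := by omega
  set q := (Nat.log 2 n + c) ^ c with hq
  by_contra hcon
  push Not at hcon
  -- everything as a power of two
  have hlogn : 2 * n + 1 ≤ 2 ^ (Nat.log 2 n + 2) := by
    have := Nat.lt_pow_succ_log_self Nat.one_lt_two n
    rw [pow_succ] at this ⊢
    omega
  have hq1 : 1 ≤ 2 ^ q := Nat.one_le_two_pow
  have hL1 : L + 1 ≤ 2 ^ (q + 1) := by rw [pow_succ]; omega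
  have HB : complexity (nestFreeMatchingPoly a ℝ≥0) ≤ 2 ^ (4 * q + 6 * Nat.log 2 n + 29) :=
    calc complexity (nestFreeMatchingPoly a ℝ≥0) ≤ 5184 * (2 * n + 1) ^ 6 * (L + 1) ^ 4 := HA
      _ ≤ 2 ^ 13 * (2 ^ (Nat.log 2 n + 2)) ^ 6 * (2 ^ (q + 1)) ^ 4 := by gcongr; norm_num
      _ = 2 ^ (4 * q + 6 * Nat.log 2 n + 29) := by ring
  have hlog : Nat.log 2 n ≤ Nat.log 2 a + 2 := by
    calc Nat.log 2 n ≤ Nat.log 2 (a * 2 * 2) := Nat.log_mono_right (by omega)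
      _ = Nat.log 2 a + 2 := by
          rw [Nat.log_mul_base Nat.one_lt_two (by positivity), Nat.log_mul_base Nat.one_lt_two ha0]
  have HE : 4 * q + 6 * Nat.log 2 n + 29 ≤ (Nat.log 2 a + (c + 36)) ^ (c + 36) := exponent_le c _ _ hlog
  have HC : complexity (nestFreeMatchingPoly a ℝ≥0) ≤ 2 ^ ((Nat.log 2 a + (c + 36)) ^ (c + 36)) :=
    HB.trans (Nat.pow_le_pow_right Nat.two_pos HE)
  -- real side: `2^{a^{1/6}} ≤ L₊(NN_a) ≤ 2^{polylog(a)} < 2^{a^{1/6}}`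
  have HR := hn₁ a (by omega)
  have HP := hn₂ a (by omega)
  have H : (2 : ℝ) ^ ((a : ℝ) ^ ((1 : ℝ) / 6)) ≤ (2 : ℝ) ^ ((((Nat.log 2 a + (c + 36)) ^ (c + 36) : ℕ) : ℝ)) := by
    calc (2 : ℝ) ^ ((a : ℝ) ^ ((1 : ℝ) / 6)) ≤ (complexity (nestFreeMatchingPoly a ℝ≥0) : ℝ) := HR
      _ ≤ ((2 ^ ((Nat.log 2 a + (c + 36)) ^ (c + 36)) : ℕ) : ℝ) := by exact_mod_cast HC
      _ = (2 : ℝ) ^ ((((Nat.log 2 a + (c + 36)) ^ (c + 36) : ℕ) : ℝ)) := by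
          rw [Nat.cast_pow, Nat.cast_ofNat, Real.rpow_natCast]
  have H' := (Real.rpow_le_rpow_left_iff one_lt_two).1 H
  linarith

/-- ★★ **STACK POWERS ARE NOT CERTIFICATES — the instance `h ∈ {NC_n^k : k ∈ ℕ}` of the route decl
`Theses.FifoMatching.NNDivisionHard` (stmt-ValiantsHypothesis-21181), PROVED uniformly in `k`:** for every `c`, eventually in
`n`, `2^((log₂ n + c)^c) < L₊(NN_n · NC_n^k) + L₊(NC_n^k)` for EVERY `k` (the route's inlined `NN_n` over `ℝ≥0` is
definitionally `nestFreeMatchingPoly n ℝ≥0`).  The residual test cofactor of the unsaturated / content-free tier — cheap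
(`L₊(NC_n^k) = O(n³ + log k)`), hyper-degree, torus-homogeneous, carrying no monomial inside a typical nest-free matching —
is thereby eliminated: «stack powers do not help the queue».  HONEST FRAMING: one explicit cofactor family leaves the open
residual of stmt-21181; the crux itself (all `h ≠ 0`) stays OPEN; nothing here bears on `NNNotVP` or on VP ≠ VNP.
[cite: JuknaSeiwertSergeev2022, Thm 1] [cite: HrubesYehudayoff2021, §6 Problem 2] -/
theorem stackPower_not_certificate_qp (c : ℕ) : ∃ n₀ : ℕ, ∀ n : ℕ, n₀ ≤ n → ∀ k : ℕ,
    2 ^ ((Nat.log 2 n + c) ^ c) <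
      complexity (nestFreeMatchingPoly n ℝ≥0 * (noncrossingMatchingPoly n ℝ≥0) ^ k) +
        complexity ((noncrossingMatchingPoly n ℝ≥0) ^ k) := by
  obtain ⟨n₀, hn₀⟩ := qp_threshold c
  refine ⟨max n₀ 7, fun n hn k => ?_⟩
  have h1 : 4 * ((n + 2) / 3) + 2 ≤ 2 * n := by omega
  have h2 : n ≤ 3 * ((n + 2) / 3) + 1 := by omega
  exact lt_of_lt_of_le (hn₀ n (le_of_max_le_left hn) _ (complexity_nn_le_of_stackPower h1 h2 k))
    (Nat.le_add_right _ _)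

/-- ★★ **GENERIC COFACTORS ARE NOT CERTIFICATES (quasi-polynomial reading).**  For every `c`, eventually in `n`: for EVERY
cofactor `h` that is generic in the pinned rainbow direction `prWeight n ⌊(n+2)/3⌋` (a unique maximal monomial `x^e`),
`2^((log₂ n + c)^c) < L₊(NN_n · h) + L₊(h)` — the crux inequality of `Theses.FifoMatching.NNDivisionHard` on this whole
class of cofactors (which contains every power `NC_n^k`, every monomial multiple `x^u · NC_n^k`, and every `h` whose Newton
polytope has a vertex exposed by that direction).  HONEST FRAMING: the crux itself (all `h ≠ 0`) stays OPEN; VP ≠ VNP untouched.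
[cite: JuknaSeiwertSergeev2022, Thm 1] [cite: HrubesYehudayoff2021, §6 Problem 2] -/
theorem generic_not_certificate_qp (c : ℕ) : ∃ n₀ : ℕ, ∀ n : ℕ, n₀ ≤ n →
    ∀ h : MvPolynomial (Fin (2 * n) × Fin (2 * n)) ℝ≥0, ∀ e ∈ h.support,
      (∀ e' ∈ h.support, e' ≠ e →
        Finsupp.weight (prWeight n ((n + 2) / 3)) e' < Finsupp.weight (prWeight n ((n + 2) / 3)) e) →
      2 ^ ((Nat.log 2 n + c) ^ c) < complexity (nestFreeMatchingPoly n ℝ≥0 * h) + complexity h := by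
  obtain ⟨n₀, hn₀⟩ := qp_threshold c
  refine ⟨max n₀ 7, fun n hn h e he hgen => ?_⟩
  have h1 : 4 * ((n + 2) / 3) + 2 ≤ 2 * n := by omega
  have h2 : n ≤ 3 * ((n + 2) / 3) + 1 := by omega
  exact lt_of_lt_of_le (hn₀ n (le_of_max_le_left hn) _ (complexity_nn_le_of_generic h1 h2 h he hgen))
    (Nat.le_add_right _ _)

end Summit.ValiantsHypothesis.ValiantsHypothesis.Theorems.FifoMatching.NNDivisionHard.StackPowersQueue

end
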